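import Summits.CriticalPhenomena.SAWScalingLimit.Theorems.ObservableToSLE.Negative.HalfDiscMesh

/-!
# The floor class of the line `floor-ratio-restriction-bootstrap` is inhabited (crux `ObservableToSLE`,
stmt-CriticalPhenomena-10472; cdisprove cycle 4) — part 2 of the floor-class non-vacuity certificate

Negative/structural lemma (refuter).  The picked line identifies subsequential limits first on the
FLOOR CLASS: floor domains `IsFloorDomain D ρ` (Jordan, above the horizontal line through the two
marked points, flat half-discs at both) with floor-vertex endpoint approximations
`IsFloorEndpointApprox D a b` (an `IsEmbEndpointApprox` of the CANONICAL discretisation `Ω_δ` whose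
endpoints have a honeycomb neighbour on or below the floor).  Stubs 4, 5 and the premise
`FloorIdentification` of the W2 stub 7 quantify over this class; were it EMPTY, they would be vacuous
and the whole content of the line would sit in stub 7.  With the half-disc engine of part 1
(`HalfDiscMesh.lean`: `hexDomainGraph_HD_reachable`) this file certifies that it is not, on
`(HD; 1/4, 0)`:

* §2 the floor endpoints `aF δ = fj (2 X(2δ)) 0 → 1/4` (`X = ⌈1/(2·)⌉`, `|δ X(2δ) − 1/4| ≤ δ`) and
  `bF = fj 0 0 → 0`, mesh vertices of `HD`, joined in `Ω_δ(HD)`, each with its vertical edge going to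
  row `−1` (on or below the floor): `isEmbEndpointApprox_halfDisc_floor`, `floor_adjacent`;
* §3 flatness at BOTH marked points (`flat_quarter`) and `floorClass_inhabited`: `∃ D ρ a b`, the
  UNFOLDED `IsFloorDomain D ρ ∧ IsFloorEndpointApprox D a b` (`D = halfDiscDomain (1/4)`, `ρ = 1/4`).
Everything proved. [folklore]
-/

noncomputable section

open Set Filter Topology Complex
open Literature.Probability.RandomPlanarGeometry
open UpperHalfPlane (upperHalfPlaneSet)
open Literature.Probability.LatticeModels Literature.Probability.RandomPlanarGeometry.SAW
open Summit.CriticalPhenomena.SAWScalingLimit.Theorems.BoundaryClosure.Negative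

namespace Summit.CriticalPhenomena.SAWScalingLimit.Theorems.ObservableToSLE.Negative

/-! ## §2 Floor endpoints of the half-disc `(HD; 1/4, 0)` -/

/-- The floor vertex at `1/4`: the bottom up-face of cell `X(2δ) = ⌈1/(4δ)⌉`. -/
def aF (δ : ℝ) : HexVertex := fj (2 * Xc (2 * δ)) 0

/-- The floor vertex at `0`: the origin face `fj 0 0`. -/
def bF : HexVertex := fj 0 0

/-- `|δ X(2δ) − 1/4| ≤ δ`. [folklore] -/
theorem abs_Xc_two {δ : ℝ} (hδ : 0 < δ) : |δ * Xc (2 * δ) - 1 / 4| ≤ δ := by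
  have h := abs_Xc (2 * δ) (by linarith)
  rw [abs_le] at h ⊢
  constructor <;> linarith [h.1, h.2]

/-- `δ · c(aF δ)` in coordinates: `δ(X(2δ) + 1/2) + i δ√3/6`. [folklore] -/
theorem smul_hexCenter_aF (δ : ℝ) :
    (δ : ℂ) * hexCenter (aF δ) =
      ((δ * ((Xc (2 * δ) : ℝ) + 1 / 2) : ℝ) : ℂ) + ((δ * (Real.sqrt 3 / 6) : ℝ) : ℂ) * Complex.I := by
  have hre : (hexCenter (aF δ)).re = (Xc (2 * δ) : ℝ) + 1 / 2 := by
    unfold aF; rw [re_hexCenter_fj]; push_cast; ring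
  have him : (hexCenter (aF δ)).im = Real.sqrt 3 / 6 := by
    unfold aF; rw [im_fj_even (show (2 * Xc (2 * δ)) % 2 = 0 by omega)]; push_cast; ring
  apply Complex.ext
  · simp [hre]
  · simp [him]

/-- `δ · c(bF)` in coordinates: `δ/2 + i δ√3/6`. [folklore] -/
theorem smul_hexCenter_bF (δ : ℝ) :
    (δ : ℂ) * hexCenter bF = ((δ * (1 / 2) : ℝ) : ℂ) + ((δ * (Real.sqrt 3 / 6) : ℝ) : ℂ) * Complex.I := by
  have hre : (hexCenter bF).re = 1 / 2 := by
    unfold bF; rw [re_hexCenter_fj]; push_cast; ring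
  have him : (hexCenter bF).im = Real.sqrt 3 / 6 := by
    unfold bF; rw [im_fj_even (show (0 : ℤ) % 2 = 0 by omega)]; push_cast; ring
  apply Complex.ext
  · simp [hre]
  · simp [him]

/-- **`δ · c(aF δ) → 1/4`.** [folklore] -/
theorem tendsto_aF :
    Tendsto (fun δ : ℝ => (δ : ℂ) * hexCenter (aF δ)) (𝓝[>] (0 : ℝ)) (𝓝 (((1 / 4 : ℝ)) : ℂ)) := by
  have h0 : Tendsto (fun δ : ℝ => δ) (𝓝[>] (0 : ℝ)) (𝓝 0) :=
    tendsto_nhdsWithin_of_tendsto_nhds tendsto_id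
  have h1 : Tendsto (fun δ : ℝ => δ * ((Xc (2 * δ) : ℝ) + 1 / 2)) (𝓝[>] (0 : ℝ)) (𝓝 (1 / 4)) := by
    have e : (fun δ : ℝ => δ * ((Xc (2 * δ) : ℝ) + 1 / 2)) =
        fun δ : ℝ => δ * ((Xc (2 * δ) : ℝ) + 5 / 4) - δ * (3 / 4) := by
      funext δ; ring
    rw [e, show (1 / 4 : ℝ) = 1 / 4 - 0 * (3 / 4) by norm_num]
    exact (tendsto_mul_cell (n := fun δ => (Xc (2 * δ) : ℝ)) fun δ hδ => abs_Xc_two hδ).sub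
      (h0.mul_const (3 / 4))
  have h2 : Tendsto (fun δ : ℝ => δ * (Real.sqrt 3 / 6)) (𝓝[>] (0 : ℝ)) (𝓝 0) := by
    simpa using h0.mul_const (Real.sqrt 3 / 6)
  have h3 := ((Complex.continuous_ofReal.tendsto _).comp h1).add
    (((Complex.continuous_ofReal.tendsto 0).comp h2).mul_const Complex.I)
  simp only [Function.comp_def, Complex.ofReal_zero, zero_mul, add_zero] at h3
  refine h3.congr' (Eventually.of_forall fun δ => ?_)
  beta_reduce
  rw [smul_hexCenter_aF]

/-- **`δ · c(bF) → 0`.** [folklore] -/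
theorem tendsto_bF : Tendsto (fun δ : ℝ => (δ : ℂ) * hexCenter bF) (𝓝[>] (0 : ℝ)) (𝓝 0) := by
  have h0 : Tendsto (fun δ : ℝ => (δ : ℂ)) (𝓝[>] (0 : ℝ)) (𝓝 0) :=
    (Complex.continuous_ofReal.tendsto' 0 0 Complex.ofReal_zero).mono_left nhdsWithin_le_nhds
  simpa using h0.mul_const (hexCenter bF)

/-- `aF δ` is a mesh vertex of the half-disc for `0 < δ ≤ 1/16`. [folklore] -/
theorem aF_mem {δ : ℝ} (hδ : 0 < δ) (hδ' : δ ≤ 1 / 16) : aF δ ∈ meshHD δ := by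
  rw [mem_meshHD_iff hδ]
  refine ⟨?_, by unfold aF; exact im_pos_row_zero _⟩
  have hX := abs_Xc_two hδ
  rw [abs_le] at hX
  have hsq : (δ * ‖hexCenter (aF δ)‖) ^ 2 < 1 := by
    rw [mul_pow]
    unfold aF
    rw [norm_sq_bottom_even]
    have h1 : δ * ((Xc (2 * δ) : ℝ) + 1 / 2) ≤ 1 / 4 + δ + δ / 2 := by nlinarith [hX.2]
    have h2 : 0 ≤ δ * ((Xc (2 * δ) : ℝ) + 1 / 2) := by nlinarith [hX.1]
    have h3 : (δ * ((Xc (2 * δ) : ℝ) + 1 / 2)) ^ 2 ≤ (1 / 4 + δ + δ / 2) ^ 2 := by nlinarith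
    have h4 : δ ^ 2 * (1 / 12) ≤ 1 / 12 := by nlinarith
    nlinarith
  have hnn : 0 ≤ δ * ‖hexCenter (aF δ)‖ := by positivity
  nlinarith

/-- `bF` is a mesh vertex of the half-disc for `0 < δ < 1`. [folklore] -/
theorem bF_mem {δ : ℝ} (hδ : 0 < δ) (hδ1 : δ < 1) : bF ∈ meshHD δ := origin_mem hδ hδ1

/-- `0 < 1/4 < 1`. [folklore] -/
theorem quarter_mem : (0 : ℝ) < 1 / 4 ∧ (1 / 4 : ℝ) < 1 := by norm_num

/-- **NON-VACUITY, endpoints**: `(aF, bF)` is an endpoint approximation of the CANONICAL honeycomb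
discretisation of the half-disc `(HD; 1/4, 0)`. [folklore] -/
theorem isEmbEndpointApprox_halfDisc_floor :
    IsEmbEndpointApprox hexGraph hexCenter (halfDiscDomain (1 / 4) quarter_mem) aF (fun _ => bF) where
  reachable := by
    filter_upwards [eventually_small one_pos] with δ hδ
    obtain ⟨hδ, hδ', -⟩ := hδ
    exact hexDomainGraph_HD_reachable hδ (by linarith) (aF_mem hδ hδ') (bF_mem hδ (by linarith))
  tendsto_fst := by rw [pt_zero_halfDiscDomain]; exact tendsto_aF
  tendsto_snd := by rw [pt_one_halfDiscDomain]; exact tendsto_bF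

/-- Both endpoints are FLOOR vertices: their vertical edge goes to row `−1`, whose rescaled centre lies
on or below the real axis (`δ ≥ 0`). [folklore] -/
theorem floor_adjacent {δ : ℝ} (hδ : 0 ≤ δ) :
    (∃ u : HexVertex, hexGraph.Adj (aF δ) u ∧
      ((δ : ℂ) * hexCenter u).im ≤ ((halfDiscDomain (1 / 4) quarter_mem).pt 0).im) ∧
    (∃ u : HexVertex, hexGraph.Adj bF u ∧
      ((δ : ℂ) * hexCenter u).im ≤ ((halfDiscDomain (1 / 4) quarter_mem).pt 1).im) := by
  have hs : 0 < Real.sqrt 3 / 2 := by positivity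
  have key : ∀ j : ℤ, j % 2 = 0 → ((δ : ℂ) * hexCenter (fj (j + 1) (0 - 1))).im ≤ 0 := by
    intro j hj
    rw [Complex.im_ofReal_mul, im_fj_odd (show (j + 1) % 2 = 1 by omega)]
    push_cast
    exact mul_nonpos_of_nonneg_of_nonpos hδ
      (mul_nonpos_of_nonpos_of_nonneg (by norm_num) hs.le)
  rw [pt_zero_halfDiscDomain, pt_one_halfDiscDomain, Complex.ofReal_im, Complex.zero_im]
  exact ⟨⟨_, adj_fj_down (show (2 * Xc (2 * δ)) % 2 = 0 by omega) 0, key _ (by omega)⟩,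
    ⟨_, adj_fj_down (show (0 : ℤ) % 2 = 0 by omega) 0, key _ (by omega)⟩⟩

/-! ## §3 The floor class is inhabited -/

/-- **Flatness at BOTH marked points**: inside the quarter-balls about `1/4` and `0` the half-disc
is the upper half-plane. [folklore] -/
theorem flat_quarter (i : Fin 2) :
    (halfDiscDomain (1 / 4) quarter_mem).carrier ∩
        Metric.ball ((halfDiscDomain (1 / 4) quarter_mem).pt i) (1 / 4) =
      {z : ℂ | ((halfDiscDomain (1 / 4) quarter_mem).pt i).im < z.im} ∩
        Metric.ball ((halfDiscDomain (1 / 4) quarter_mem).pt i) (1 / 4) := by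
  -- the centre `c = pt i` is real with `|c| ≤ 1/4`, so `B(c, 1/4) ⊆ B(0, 1/2) ⊆` the unit disc
  have hc : ∃ c : ℝ, |c| ≤ 1 / 4 ∧ (halfDiscDomain (1 / 4) quarter_mem).pt i = (c : ℂ) := by
    fin_cases i
    · refine ⟨1 / 4, by rw [abs_of_pos (by norm_num)], ?_⟩
      show (halfDiscDomain (1 / 4) quarter_mem).pt 0 = (((1 / 4 : ℝ)) : ℂ)
      rw [pt_zero_halfDiscDomain]
    · refine ⟨0, by norm_num, ?_⟩
      show (halfDiscDomain (1 / 4) quarter_mem).pt 1 = ((0 : ℝ) : ℂ)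
      rw [pt_one_halfDiscDomain]; simp
  obtain ⟨c, hc, hpt⟩ := hc
  rw [hpt]
  ext z
  show z ∈ HD ∩ Metric.ball (c : ℂ) (1 / 4) ↔ _
  simp only [HD, mem_inter_iff, mem_setOf_eq, Complex.ofReal_im, Metric.mem_ball]
  constructor
  · rintro ⟨⟨-, h⟩, h'⟩; exact ⟨h, h'⟩
  · rintro ⟨h, h'⟩
    refine ⟨⟨?_, h⟩, h'⟩
    have hz : ‖z - (c : ℂ)‖ < 1 / 4 := by rwa [← dist_eq_norm]
    have hcn : ‖(c : ℂ)‖ = |c| := by rw [Complex.norm_real, Real.norm_eq_abs]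
    calc ‖z‖ = ‖(z - (c : ℂ)) + (c : ℂ)‖ := by rw [sub_add_cancel]
      _ ≤ ‖z - (c : ℂ)‖ + ‖(c : ℂ)‖ := norm_add_le _ _
      _ < 1 / 4 + 1 / 4 := by rw [hcn]; linarith
      _ < 1 := by norm_num

/-- **The floor class of the line `floor-ratio-restriction-bootstrap` is inhabited**: the half-disc
`(HD; 1/4, 0)` with `ρ = 1/4` is a floor domain (`IsFloorDomain`, unfolded: positive radius, marked
points at one height, the domain above that line, flat at both marked points) and `(aF, bF)` is a
floor-vertex endpoint approximation of its CANONICAL discretisation (`IsFloorEndpointApprox`,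
unfolded).  Hence `FloorIdentification`, `stub_canonicalTransfer`, `stub_chordalCarrier` and the
premise of `stub_domainExtension` are NOT vacuous. [folklore] -/
theorem floorClass_inhabited :
    ∃ (D : DobrushinDomain) (ρ : ℝ) (a b : ℝ → HexVertex),
      (0 < ρ ∧ (D.pt 1).im = (D.pt 0).im ∧ D.carrier ⊆ {z : ℂ | (D.pt 0).im < z.im} ∧
        D.carrier ∩ Metric.ball (D.pt 0) ρ = {z : ℂ | (D.pt 0).im < z.im} ∩ Metric.ball (D.pt 0) ρ ∧
        D.carrier ∩ Metric.ball (D.pt 1) ρ = {z : ℂ | (D.pt 1).im < z.im} ∩ Metric.ball (D.pt 1) ρ) ∧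
      (IsEmbEndpointApprox hexGraph hexCenter D a b ∧
        ∀ᶠ δ : ℝ in 𝓝[>] 0,
          (∃ u : HexVertex, hexGraph.Adj (a δ) u ∧ ((δ : ℂ) * hexCenter u).im ≤ (D.pt 0).im) ∧
          (∃ u : HexVertex, hexGraph.Adj (b δ) u ∧ ((δ : ℂ) * hexCenter u).im ≤ (D.pt 1).im)) := by
  refine ⟨halfDiscDomain (1 / 4) quarter_mem, 1 / 4, aF, fun _ => bF,
    ⟨by norm_num, ?_, ?_, flat_quarter 0, flat_quarter 1⟩, isEmbEndpointApprox_halfDisc_floor, ?_⟩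
  · rw [pt_zero_halfDiscDomain, pt_one_halfDiscDomain]; simp
  · rw [pt_zero_halfDiscDomain]
    intro z hz
    simp only [mem_setOf_eq, Complex.ofReal_im]
    exact hz.2
  · filter_upwards [self_mem_nhdsWithin] with δ hδ
    exact floor_adjacent (le_of_lt hδ)

end Summit.CriticalPhenomena.SAWScalingLimit.Theorems.ObservableToSLE.Negative

end
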